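import Summits.ValiantsHypothesis.ValiantsHypothesis.Theorems.BarrierLeverTransversalMinorLayoutsRankSix
import Summits.ValiantsHypothesis.ValiantsHypothesis.Theorems.BarrierLeverTransversalMinorLayoutsSevenFaces
import Summits.ValiantsHypothesis.ValiantsHypothesis.Theorems.BarrierLeverTransversalMinorLayoutsSevenFacesNoDegTwo
import Summits.ValiantsHypothesis.ValiantsHypothesis.Theorems.BarrierLeverTransversalMinorLayoutsLockedCertsSeven

/-!
# Route BarrierLever — conjecture TT (`TransversalMinorLayoutsNonsingular`, stmt-ValiantsHypothesis-19152):
# the locked cells with seven faces at heights 6 and 5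

Helper file (`--supports stmt-ValiantsHypothesis-19152`; cell valiant-natproofs, rung V4, 𝒟-side of
door (c); seat val-np-p1 gen 8).  The bounded locked-complex engine
(`FiniteCheck.tt_rank_le_of_lockedCore`) leaves, for seven rows, locked pairs of complexes at
heights `4, 5, 6` with one side using every coordinate.  This file settles the two upper cells by
transporting the kernel certificates of `…LockedCertsSeven` (`good_of_ppDerivable_relabel`):

* `good_claw_h6` (cell `(6, 7)`): the full side is the `6`-CLAW, the other side has no vertex of
  degree one, hence is a MATCHING or a TRIANGLE (`lowerFamily_seven_no_degree_one`) — certificates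
  `claw6_v_matching_h6_derivable`, `claw6_v_triangle_h6_derivable`;
* `good_clawEdge_h5` (cell `(5, 7)`): the full side is the `5`-claw plus an edge
  (`image_eq_of_claw_edge`; degrees `1` and `2` occur), the other side has no vertex of degree one
  or two, hence is a triangle — certificate `claw5edge_v_triangle_h5_derivable`.

The coordinate relabelings come from `Equiv.Perm.exists_extending_pair`.  The cell `(4, 7)` and the
assembly of TT for `r ≤ 7` are in `…RankSeven`.

WHAT THIS IS NOT: two cells of a bounded-rank slice of TT; nothing on TT / item 19761 in general,
on crux stmt-ValiantsHypothesis-14610, or on `VP` versus `VNP`.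
-/

-- layout Summits/ValiantsHypothesis/ValiantsHypothesis forces the duplicated namespace component
set_option linter.dupNamespace false

open Matrix Finset

namespace Summit.ValiantsHypothesis.ValiantsHypothesis.Theorems.BarrierLever.FiniteCheck

open Summit.ValiantsHypothesis.ValiantsHypothesis.Theorems.BarrierLever.Compression
open Summit.ValiantsHypothesis.ValiantsHypothesis.Theorems.BarrierLever.PriorityPeeling

/-! ## 1. Small tools -/

/-- A vector of two distinct entries is injective. -/
theorem vec2_injective {n : ℕ} (a b : Fin n) (hab : a ≠ b) :
    Function.Injective (![a, b] : Fin 2 → Fin n) := by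
  intro x y hxy
  fin_cases x <;> fin_cases y
  · rfl
  · exact absurd hxy hab
  · exact absurd hxy.symm hab
  · rfl

/-- A vector of three pairwise distinct entries is injective. -/
theorem vec3_injective {n : ℕ} (a b c : Fin n) (hab : a ≠ b) (hac : a ≠ c) (hbc : b ≠ c) :
    Function.Injective (![a, b, c] : Fin 3 → Fin n) := by
  intro x y hxy
  fin_cases x <;> fin_cases y
  · rfl
  · exact absurd hxy hab
  · exact absurd hxy hac
  · exact absurd hxy.symm hab
  · rfl
  · exact absurd hxy hbc
  · exact absurd hxy.symm hac
  · exact absurd hxy.symm hbc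
  · rfl

/-- A vector of four pairwise distinct entries is injective. -/
theorem vec4_injective {n : ℕ} (a b c d : Fin n) (hab : a ≠ b) (hac : a ≠ c) (had : a ≠ d)
    (hbc : b ≠ c) (hbd : b ≠ d) (hcd : c ≠ d) :
    Function.Injective (![a, b, c, d] : Fin 4 → Fin n) := by
  intro x y hxy
  fin_cases x <;> fin_cases y
  · rfl
  · exact absurd hxy hab
  · exact absurd hxy hac
  · exact absurd hxy had
  · exact absurd hxy.symm hab
  · rfl
  · exact absurd hxy hbc
  · exact absurd hxy hbd
  · exact absurd hxy.symm hac
  · exact absurd hxy.symm hbc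
  · rfl
  · exact absurd hxy hcd
  · exact absurd hxy.symm had
  · exact absurd hxy.symm hbd
  · exact absurd hxy.symm hcd
  · rfl


/-- The face family of an injective lower-set layout is a lower family of `r` sets, and degrees
can be read on it. -/
theorem image_lowerFamily {h r : ℕ} (w : Fin r → Finset (Fin h)) (hw : Function.Injective w)
    (hlw : IsLowerSet (Set.range w)) :
    (∀ x ∈ Finset.univ.image w, ∀ t, t ⊆ x → t ∈ Finset.univ.image w) ∧
    (Finset.univ.image w).card = r ∧
    ∀ c : Fin h, ((Finset.univ.image w).filter fun y => c ∈ y).card =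
      (Finset.univ.filter fun j => c ∈ w j).card := by
  classical
  refine ⟨?_, ?_, ?_⟩
  · intro x hx t ht
    obtain ⟨i, _, rfl⟩ := Finset.mem_image.mp hx
    obtain ⟨j, hj⟩ := hlw ht ⟨i, rfl⟩
    exact Finset.mem_image.mpr ⟨j, Finset.mem_univ _, hj⟩
  · rw [Finset.card_image_of_injective _ hw, Finset.card_univ, Fintype.card_fin]
  · intro c
    rw [Finset.filter_image, Finset.card_image_of_injective _ hw]

/-- In a matching `∅, a, b, c, d, ab, cd` the vertex `a` has degree two. -/
theorem degree_two_of_matching {h : ℕ} (F : Finset (Finset (Fin h))) (a b c d : Fin h)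
    (hab : a ≠ b) (hac : a ≠ c) (had : a ≠ d) (haF : ({a} : Finset (Fin h)) ∈ F)
    (habF : ({a, b} : Finset (Fin h)) ∈ F)
    (hall : ∀ y ∈ F, y = ∅ ∨ y = {a} ∨ y = {b} ∨ y = {c} ∨ y = {d} ∨ y = {a, b} ∨ y = {c, d}) :
    (F.filter fun y => a ∈ y).card = 2 := by
  classical
  have : (F.filter fun y => a ∈ y) = {{a}, {a, b}} := by
    ext y
    simp only [Finset.mem_filter, Finset.mem_insert, Finset.mem_singleton]
    constructor
    · rintro ⟨hy, hay⟩
      rcases hall y hy with rfl | rfl | rfl | rfl | rfl | rfl | rfl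
      · simp at hay
      · exact Or.inl rfl
      · simp only [Finset.mem_singleton] at hay; exact absurd hay hab
      · simp only [Finset.mem_singleton] at hay; exact absurd hay hac
      · simp only [Finset.mem_singleton] at hay; exact absurd hay had
      · exact Or.inr rfl
      · simp only [Finset.mem_insert, Finset.mem_singleton] at hay
        rcases hay with e | e
        · exact absurd e hac
        · exact absurd e had
    · rintro (rfl | rfl)
      · exact ⟨haF, by simp⟩
      · exact ⟨habF, by simp⟩
  rw [this, Finset.card_pair]
  intro e
  have : b ∈ ({a} : Finset (Fin h)) := by rw [e]; simp
  exact hab (Finset.mem_singleton.mp this).symm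

/-! ## 2. Cell (6, 7): the claw against a matching or a triangle -/

/-- **Cell `(6, 7)`.**  A `6`-claw `u` against a seven-face complex `w` without a vertex of
degree one is GOOD. -/
theorem good_claw_h6 (u w : Fin 7 → Finset (Fin 6)) (hu : Function.Injective u)
    (hw : Function.Injective w) (hlu : IsLowerSet (Set.range u)) (hlw : IsLowerSet (Set.range w))
    (hfull : ∀ a : Fin 6, ∃ i, a ∈ u i)
    (hdeg : ∀ c : Fin 6, (Finset.univ.filter fun j => c ∈ w j).card ≠ 1) :
    ∃ H : Matrix (Fin (6 + 6)) (Fin (6 + 6)) ℂ, (Matrix.of fun i j : Fin 7 => (H.submatrix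
      (fun a : Fin 6 => if a ∈ u i then Fin.castAdd 6 a else Fin.natAdd 6 a)
      (fun c : Fin 6 => if c ∈ w j then Fin.natAdd 6 c else Fin.castAdd 6 c)).det).det ≠ 0 := by
  classical
  obtain ⟨hlow, hcard, hdegeq⟩ := image_lowerFamily w hw hlw
  have hdeg' : ∀ c : Fin 6, ((Finset.univ.image w).filter fun y => c ∈ y).card ≠ 1 :=
    fun c => by rw [hdegeq]; exact hdeg c
  -- the rows: faces of the standard claw
  have hrows : ∀ i, ∃ i', (u i).map (Equiv.refl (Fin 6)).toEmbedding =
      (![∅, {0}, {1}, {2}, {3}, {4}, {5}] : Fin 7 → Finset (Fin 6)) i' := by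
    intro i
    have hi := face_card_le_one_of_claw u hu hlu hfull rfl i
    rw [Equiv.refl_toEmbedding, Finset.map_refl]
    rcases Nat.lt_or_ge (u i).card 1 with h0 | h1
    · rw [Finset.card_eq_zero.mp (show (u i).card = 0 by omega)]
      exact ⟨0, rfl⟩
    · obtain ⟨x, hx⟩ := Finset.card_eq_one.mp (le_antisymm hi h1)
      rw [hx]
      exact (by decide : ∀ x : Fin 6, ∃ i' : Fin 7, ({x} : Finset (Fin 6)) =
        (![∅, {0}, {1}, {2}, {3}, {4}, {5}] : Fin 7 → Finset (Fin 6)) i') x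
  rcases lowerFamily_seven_no_degree_one _ hlow hcard hdeg' with
    ⟨a, b, c, d, hab, hac, had, hbc, hbd, hcd, -, -, hall⟩ | ⟨a, b, c, hab, hac, hbc, hall⟩
  · -- matching
    have hinj := vec4_injective a b c d hab hac had hbc hbd hcd
    obtain ⟨π', hπ'⟩ := Equiv.Perm.exists_extending_pair (![a, b, c, d] : Fin 4 → Fin 6)
      (![0, 1, 2, 3] : Fin 4 → Fin 6) hinj (by decide)
    have hπa : π' a = 0 := hπ' 0
    have hπb : π' b = 1 := hπ' 1
    have hπc : π' c = 2 := hπ' 2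
    have hπd : π' d = 3 := hπ' 3
    refine good_of_ppDerivable_relabel u w _ _ hu hw (Equiv.refl _) π' hrows ?_
      claw6_v_matching_h6_derivable
    intro j
    rcases hall (w j) (Finset.mem_image.mpr ⟨j, Finset.mem_univ _, rfl⟩) with
      e | e | e | e | e | e | e <;> rw [e]
    · exact ⟨0, by simp⟩
    · exact ⟨1, by simp [hπa]⟩
    · exact ⟨2, by simp [hπb]⟩
    · exact ⟨3, by simp [hπc]⟩
    · exact ⟨4, by simp [hπd]⟩
    · exact ⟨5, by simp [Finset.map_insert, hπa, hπb]⟩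
    · exact ⟨6, by simp [Finset.map_insert, hπc, hπd]⟩
  · -- triangle
    have hinj := vec3_injective a b c hab hac hbc
    obtain ⟨π', hπ'⟩ := Equiv.Perm.exists_extending_pair (![a, b, c] : Fin 3 → Fin 6)
      (![0, 1, 2] : Fin 3 → Fin 6) hinj (by decide)
    have hπa : π' a = 0 := hπ' 0
    have hπb : π' b = 1 := hπ' 1
    have hπc : π' c = 2 := hπ' 2
    refine good_of_ppDerivable_relabel u w _ _ hu hw (Equiv.refl _) π' hrows ?_
      claw6_v_triangle_h6_derivable
    intro j
    rcases hall (w j) (Finset.mem_image.mpr ⟨j, Finset.mem_univ _, rfl⟩) with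
      e | e | e | e | e | e | e <;> rw [e]
    · exact ⟨0, by simp⟩
    · exact ⟨1, by simp [hπa]⟩
    · exact ⟨2, by simp [hπb]⟩
    · exact ⟨3, by simp [hπc]⟩
    · exact ⟨4, by simp [Finset.map_insert, hπa, hπb]⟩
    · exact ⟨5, by simp [Finset.map_insert, hπa, hπc]⟩
    · exact ⟨6, by simp [Finset.map_insert, hπb, hπc]⟩

/-! ## 3. Cell (5, 7): the claw plus an edge against a triangle -/

/-- **Cell `(5, 7)`.**  A `5`-claw plus an edge `u` against a seven-face complex `w` without
vertices of degree one or two is GOOD. -/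
theorem good_clawEdge_h5 (u w : Fin 7 → Finset (Fin 5)) (hu : Function.Injective u)
    (hw : Function.Injective w) (hlu : IsLowerSet (Set.range u)) (hlw : IsLowerSet (Set.range w))
    (hfull : ∀ a : Fin 5, ∃ i, a ∈ u i)
    (hdeg1 : ∀ c : Fin 5, (Finset.univ.filter fun j => c ∈ w j).card ≠ 1)
    (hdeg2 : ∀ c : Fin 5, (Finset.univ.filter fun j => c ∈ w j).card ≠ 2) :
    ∃ H : Matrix (Fin (5 + 5)) (Fin (5 + 5)) ℂ, (Matrix.of fun i j : Fin 7 => (H.submatrix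
      (fun a : Fin 5 => if a ∈ u i then Fin.castAdd 5 a else Fin.natAdd 5 a)
      (fun c : Fin 5 => if c ∈ w j then Fin.natAdd 5 c else Fin.castAdd 5 c)).det).det ≠ 0 := by
  classical
  obtain ⟨hlow, hcard, hdegeq⟩ := image_lowerFamily w hw hlw
  have hdeg1' : ∀ c : Fin 5, ((Finset.univ.image w).filter fun y => c ∈ y).card ≠ 1 :=
    fun c => by rw [hdegeq]; exact hdeg1 c
  -- the columns: a triangle (a matching has a vertex of degree two)
  obtain ⟨a, b, c, hab, hac, hbc, hall⟩ : ∃ a b c : Fin 5, a ≠ b ∧ a ≠ c ∧ b ≠ c ∧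
      ∀ y ∈ Finset.univ.image w, y = ∅ ∨ y = {a} ∨ y = {b} ∨ y = {c} ∨ y = {a, b} ∨
        y = {a, c} ∨ y = {b, c} := by
    rcases lowerFamily_seven_no_degree_one _ hlow hcard hdeg1' with
      ⟨a, b, c, d, hab, hac, had, hbc, hbd, hcd, haF, habF, hall⟩ | htri
    · exfalso
      apply hdeg2 a
      rw [← hdegeq]
      exact degree_two_of_matching _ a b c d hab hac had haF habF hall
    · exact htri
  -- the rows: claw plus the edge `{p, q}`
  obtain ⟨p, q, hpq, himg⟩ := image_eq_of_claw_edge u hu hlu hfull rfl (by norm_num)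
  have hinjr := vec2_injective p q hpq
  obtain ⟨π, hπ⟩ := Equiv.Perm.exists_extending_pair (![p, q] : Fin 2 → Fin 5)
    (![0, 1] : Fin 2 → Fin 5) hinjr (by decide)
  have hπp : π p = 0 := hπ 0
  have hπq : π q = 1 := hπ 1
  have hinjc := vec3_injective a b c hab hac hbc
  obtain ⟨π', hπ'⟩ := Equiv.Perm.exists_extending_pair (![a, b, c] : Fin 3 → Fin 5)
    (![0, 1, 2] : Fin 3 → Fin 5) hinjc (by decide)
  have hπa : π' a = 0 := hπ' 0
  have hπb : π' b = 1 := hπ' 1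
  have hπc : π' c = 2 := hπ' 2
  refine good_of_ppDerivable_relabel u w _ _ hu hw π π' ?_ ?_ claw5edge_v_triangle_h5_derivable
  · intro i
    have hi : u i ∈ Finset.univ.image u := Finset.mem_image.mpr ⟨i, Finset.mem_univ _, rfl⟩
    rw [himg, Finset.mem_insert, Finset.mem_insert, Finset.mem_image] at hi
    rcases hi with e | e | ⟨x, _, e⟩
    · rw [e]
      exact ⟨6, by simp [Finset.map_insert, hπp, hπq]⟩
    · rw [e]
      exact ⟨0, by simp⟩
    · rw [← e, Finset.map_singleton]
      exact (by decide : ∀ y : Fin 5, ∃ i' : Fin 7, ({y} : Finset (Fin 5)) =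
        (![∅, {0}, {1}, {2}, {3}, {4}, {0, 1}] : Fin 7 → Finset (Fin 5)) i') (π x)
  · intro j
    rcases hall (w j) (Finset.mem_image.mpr ⟨j, Finset.mem_univ _, rfl⟩) with
      e | e | e | e | e | e | e <;> rw [e]
    · exact ⟨0, by simp⟩
    · exact ⟨1, by simp [hπa]⟩
    · exact ⟨2, by simp [hπb]⟩
    · exact ⟨3, by simp [hπc]⟩
    · exact ⟨4, by simp [Finset.map_insert, hπa, hπb]⟩
    · exact ⟨5, by simp [Finset.map_insert, hπa, hπc]⟩
    · exact ⟨6, by simp [Finset.map_insert, hπb, hπc]⟩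

end Summit.ValiantsHypothesis.ValiantsHypothesis.Theorems.BarrierLever.FiniteCheck
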